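import Summits.NavierStokesRegularity.FluidComputer.Besov32Clock
import Summits.NavierStokesRegularity.FluidComputer.SpectralFront
import Literature.Analysis.FunctionSpaces.LittlewoodPaleySobolevSquareFunction
import HarnessLib

/-!
# Fluid computer — L57: the optimal row in the PRINTED currency, `‖u(t)‖_{Ḣ^{3/2}} ≥ c √(ν/(T − t))`
# (Cheskidov–Zaya 2016, Thm. 2.4), and the merger of the dyadic and Sobolev currencies

HONEST FRAMING (cell `pub-fluidc`, verbatim): *low prior, high value-of-information experiment on Tao's
machine paradigm; NOT a claim that NS blows up.* Theorem side of the cell (the level dictionary); nothing here is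
evidence of blow-up.

The dictionary has used two currencies for the same regularity scale: the DYADIC rows `∑_j 4^{sj} ‖Δ̇_j u(t)‖₂²`
(L20, L53, L54, L56) and the FOURIER-SIDE seminorms `‖u(t)‖_{Ḣ^s} = (∫ ‖ξ‖^{2s} ‖û(t)(ξ)‖² dξ)^{1/2}` (L52, L52″).
The Literature file `LittlewoodPaleySobolevSquareFunction` (this generation) proves `Ḃ^s_{2,2} = Ḣ^s` with
equivalent norms for every real `s` (`∑_j 4^{sj}‖Δ̇_j f‖₂² ≤ 8·4^{|s|}‖f‖²_{Ḣ^s} ≤ 16·16^{|s|} ∑_j 4^{sj}‖Δ̇_j f‖₂²`).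
This file carries it to the dictionary's vector fields and reads L56 in print:

* `tsum_weight_blockL2_sq_le`, `eHomSobolevSeminorm_sq_le_tsum_weight_blockL2` — the two-sided comparison for a
  finite-energy field `v : ℝ³ → ℝ³` (`blockL2 v j = ‖Δ̇_j v‖₂`, `Function.eHomSobolevSeminorm s (complexify ∘ v)`);
* `homSobolev32_clock_sq`, `homSobolev32_clock` (**L57 — CHESKIDOV–ZAYA'S THEOREM 2.4 AS PRINTED, with `ν`**) —
  there is an absolute `c > 0` with `c ν/(T − t) ≤ ‖u(t)‖²_{Ḣ^{3/2}}`, i.e.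
  `c^{1/2} ν^{1/2} (T − t)^{−1/2} ≤ ‖u(t)‖_{Ḣ^{3/2}}`, at EVERY `t ∈ (0, T)` along every maximal smooth Leray–Hopf
  solution of the unforced system on `ℝ³` — the ENDPOINT `s = 3/2` of L52 (`HomSobolevLadder.homSobolev_clock`,
  `1/2 < s < 3/2`, shape `c_s ν^{(5−2s)/4}(T−t)^{−(2s−1)/4}`) with the same shape and the optimal rate; `→ ∞` at `T`;
* `dyadic_clock_of_homSobolev` (**L52 IN THE ℓ² DYADIC CURRENCY**) — for every `s ∈ (1/2, 3/2)`:
  `c'_s ν^{(5−2s)/2}(T − t)^{−(2s−1)/2} ≤ ∑_j 4^{sj} ‖Δ̇_j u(t)‖₂²` — the scaling-sharp ℓ² rows below `3/2`, which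
  the ℓ¹ ladder L51 gave only after a Cauchy–Schwarz loss (gen 17's idea (e), now lossless);
* `homSobolev32_clock_of_cascadeWitness` — read on the interface.

0 sorry; no definitions; no named facts.

## References

* A. Cheskidov, K. Zaya, J. Math. Phys. 57 (2016) 023101 = arXiv:1503.01784, Thm. 2.4 (p. 6). [CheskidovZaya2016]
* H. Bahouri, J.-Y. Chemin, R. Danchin, Grundlehren 343 (2011), Prop. 2.10, §2.3 (`Ḃ^s_{2,2} = Ḣ^s`).
  [BahouriCheminDanchin2011]
* J. C. Robinson, W. Sadowski, R. P. Silva, J. Math. Phys. 53 (2012) 115618, Thm. 1.1. [RobinsonSadowskiSilva2012]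
-/

noncomputable section

open MeasureTheory SchwartzMap FourierTransform Set Function Filter Topology
open scoped ENNReal NNReal
open Literature.Analysis.FluidPDE Literature.Analysis.FunctionSpaces
open Literature.Analysis.FluidPDE.FluidComputer
open Summit.NavierStokesRegularity.NavierStokesRegularity.Theorems.FluidComputer (x5a_of_cascadeWitness')
open Summit.NavierStokesRegularity.FluidComputer.Besov32Clock
open Summit.NavierStokesRegularity.FluidComputer.HomSobolevLadder
open Summit.NavierStokesRegularity.FluidComputer.SobolevLadderFront (tendsto_ofReal_clock_top)

namespace Summit.NavierStokesRegularity.FluidComputer.HomSobolev32Clock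

/-! ## The dyadic rows and the `Ḣ^s` seminorms of a finite-energy field are equivalent -/

/-- **`∑_j 4^{sj} ‖Δ̇_j v‖₂² ≤ 8·2^{|2s|} ‖v‖²_{Ḣ^s}`** for every finite-energy field `v : ℝ³ → ℝ³` and every real `s`
(the weighted square function `tsum_weight_mul_eLpNormDistrib_lpBlock_sq_le` applied to the complexified class
`[complexify ∘ v] ∈ L²`, whose blocks have the `L²` norms `‖Δ̇_j v‖₂`, `IsDistributionOf.eLpNormDistrib_lpBlock_eq_self`).
[cite: BahouriCheminDanchin2011, §2.3 (Ḃ^s_{2,2} = Ḣ^s)] -/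
theorem tsum_weight_blockL2_sq_le (s : ℝ) {v : EuclideanSpace ℝ (Fin 3) → EuclideanSpace ℝ (Fin 3)}
    (hv : MemLp v 2 volume) :
    ∑' j : ℤ, (2 : ℝ≥0∞) ^ (2 * s * (j : ℝ)) * blockL2 v j ^ 2 ≤
      8 * (2 : ℝ≥0∞) ^ |2 * s| * Function.eHomSobolevSeminorm s (⇑EuclideanSpace.complexify ∘ v) ^ 2 := by
  haveI : Fact (1 ≤ (2 : ℝ≥0∞)) := ⟨one_le_two⟩
  have h2 : MemLp (⇑EuclideanSpace.complexify ∘ v) 2 volume := memLp_complexify_comp hv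
  set V : Lp (EuclideanSpace ℂ (Fin 3)) 2 (volume : Measure (EuclideanSpace ℝ (Fin 3))) := h2.toLp _ with hVdef
  have hV : IsDistributionOf v (V : 𝓢'(EuclideanSpace ℝ (Fin 3), EuclideanSpace ℂ (Fin 3))) :=
    isDistributionOf_toTemperedDistribution (p := 2) hv
  have hblk : ∀ j : ℤ, blockL2 v j =
      eLpNormDistrib 2 (lpBlock j (V : 𝓢'(EuclideanSpace ℝ (Fin 3), EuclideanSpace ℂ (Fin 3)))) := fun j =>
    (hV.eLpNormDistrib_lpBlock_eq_self hv j).symm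
  have hsob : Function.eHomSobolevSeminorm s (⇑EuclideanSpace.complexify ∘ v) =
      Literature.Analysis.FunctionSpaces.eHomSobolevSeminorm s V := by
    rw [Function.eHomSobolevSeminorm, dif_pos h2]
  simp_rw [hblk, hsob]
  exact tsum_weight_mul_eLpNormDistrib_lpBlock_sq_le s V

/-- **`‖v‖²_{Ḣ^s} ≤ 2·2^{|2s|} ∑_j 4^{sj} ‖Δ̇_j v‖₂²`** for every finite-energy field `v : ℝ³ → ℝ³` and every real `s`
(`eHomSobolevSeminorm_sq_le_tsum_weight` on the complexified class). With `tsum_weight_blockL2_sq_le`: the dictionary's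
dyadic rows and its `Ḣ^s` seminorms are ONE currency up to the constants `8·2^{|2s|}`, `2·2^{|2s|}`.
[cite: BahouriCheminDanchin2011, §2.3 (Ḃ^s_{2,2} = Ḣ^s)] -/
theorem eHomSobolevSeminorm_sq_le_tsum_weight_blockL2 (s : ℝ) {v : EuclideanSpace ℝ (Fin 3) → EuclideanSpace ℝ (Fin 3)}
    (hv : MemLp v 2 volume) :
    Function.eHomSobolevSeminorm s (⇑EuclideanSpace.complexify ∘ v) ^ 2 ≤
      2 * (2 : ℝ≥0∞) ^ |2 * s| * ∑' j : ℤ, (2 : ℝ≥0∞) ^ (2 * s * (j : ℝ)) * blockL2 v j ^ 2 := by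
  haveI : Fact (1 ≤ (2 : ℝ≥0∞)) := ⟨one_le_two⟩
  have h2 : MemLp (⇑EuclideanSpace.complexify ∘ v) 2 volume := memLp_complexify_comp hv
  set V : Lp (EuclideanSpace ℂ (Fin 3)) 2 (volume : Measure (EuclideanSpace ℝ (Fin 3))) := h2.toLp _ with hVdef
  have hV : IsDistributionOf v (V : 𝓢'(EuclideanSpace ℝ (Fin 3), EuclideanSpace ℂ (Fin 3))) :=
    isDistributionOf_toTemperedDistribution (p := 2) hv
  have hblk : ∀ j : ℤ, blockL2 v j =
      eLpNormDistrib 2 (lpBlock j (V : 𝓢'(EuclideanSpace ℝ (Fin 3), EuclideanSpace ℂ (Fin 3)))) := fun j =>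
    (hV.eLpNormDistrib_lpBlock_eq_self hv j).symm
  have hsob : Function.eHomSobolevSeminorm s (⇑EuclideanSpace.complexify ∘ v) =
      Literature.Analysis.FunctionSpaces.eHomSobolevSeminorm s V := by
    rw [Function.eHomSobolevSeminorm, dif_pos h2]
  simp_rw [hblk, hsob]
  exact eHomSobolevSeminorm_sq_le_tsum_weight s V

/-! ## L57: Cheskidov–Zaya's Theorem 2.4 in the printed currency -/

/-- **L57 — THE OPTIMAL `Ḣ^{3/2}` ROW, SQUARED FORM.** There is an absolute `c > 0` such that for every `ν > 0`,
`T > 0`, every maximal smooth solution `(u, p)` of the unforced Navier–Stokes system on `ℝ³ × [0, T)` which is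
Leray–Hopf from `u 0`, and EVERY `t ∈ (0, T)`:
`c · ν · (T − t)^{−1} ≤ ‖u(t)‖²_{Ḣ^{3/2}}` (`Function.eHomSobolevSeminorm (3/2)` of the complexified slice, squared)
— L56 (`Besov32Clock.besov32_clock_rpow`, `ν/(K(T−t)) ≤ ∑_j 8^j‖Δ̇_j u(t)‖₂²`) read through `Ḃ^{3/2}_{2,2} = Ḣ^{3/2}`
(`tsum_weight_blockL2_sq_le` at `s = 3/2`: `∑_j 8^j a_j² ≤ 64 ‖u‖²_{Ḣ^{3/2}}`); `c = K⁻¹/64`.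
[cite: CheskidovZaya2016, Thm. 2.4] [cite: BahouriCheminDanchin2011, §2.3 (Ḃ^s_{2,2} = Ḣ^s)] -/
theorem homSobolev32_clock_sq :
    ∃ c : ℝ, 0 < c ∧ ∀ (ν T : ℝ), 0 < ν → 0 < T →
      ∀ (u : ℝ → EuclideanSpace ℝ (Fin 3) → EuclideanSpace ℝ (Fin 3)) (p : ℝ → EuclideanSpace ℝ (Fin 3) → ℝ),
      IsMaximalSmoothSolution ν 0 u p T → IsLerayHopfOn T ν 0 (u 0) u →
      ∀ t ∈ Ioo 0 T,
        ENNReal.ofReal (c * ν ^ (1 : ℝ) * (T - t) ^ (-(1 : ℝ))) ≤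
          Function.eHomSobolevSeminorm (3 / 2) (⇑EuclideanSpace.complexify ∘ u t) ^ 2 := by
  obtain ⟨c, hc, H⟩ := besov32_clock_rpow
  refine ⟨c / 64, by positivity, fun ν T hν hT u p hmax hLH t ht => ?_⟩
  have hTt : 0 < T - t := sub_pos.2 ht.2
  have hut : MemLp (u t) 2 volume := hLH.memLp t ⟨ht.1.le, ht.2.le⟩
  have h1 := H ν T hν hT u p hmax hLH t ht
  have h2 := tsum_weight_blockL2_sq_le (3 / 2) hut
  have e3 : (2 * (3 / 2 : ℝ)) = 3 := by norm_num
  have e64 : (8 : ℝ≥0∞) * (2 : ℝ≥0∞) ^ |(3 : ℝ)| = 64 := by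
    rw [abs_of_pos (by norm_num : (0 : ℝ) < 3), show (3 : ℝ) = ((3 : ℕ) : ℝ) by norm_num, ENNReal.rpow_natCast]
    norm_num
  simp only [e3] at h2
  rw [e64] at h2
  -- `ofReal (c/64 · …) = 64⁻¹ · ofReal (c · …)` and `ofReal (c · …) ≤ Y ≤ 64 ‖u‖²`
  have h3 : ENNReal.ofReal (c * ν ^ (1 : ℝ) * (T - t) ^ (-(1 : ℝ))) ≤
      64 * Function.eHomSobolevSeminorm (3 / 2) (⇑EuclideanSpace.complexify ∘ u t) ^ 2 := h1.trans h2
  have e : c / 64 * ν ^ (1 : ℝ) * (T - t) ^ (-(1 : ℝ)) = 64⁻¹ * (c * ν ^ (1 : ℝ) * (T - t) ^ (-(1 : ℝ))) := by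
    ring
  rw [e, ENNReal.ofReal_mul (by norm_num), ENNReal.ofReal_inv_of_pos (by norm_num : (0 : ℝ) < 64),
    ENNReal.ofReal_ofNat]
  calc (64 : ℝ≥0∞)⁻¹ * ENNReal.ofReal (c * ν ^ (1 : ℝ) * (T - t) ^ (-(1 : ℝ)))
      ≤ 64⁻¹ * (64 * Function.eHomSobolevSeminorm (3 / 2) (⇑EuclideanSpace.complexify ∘ u t) ^ 2) :=
        mul_le_mul_right h3 _
    _ = Function.eHomSobolevSeminorm (3 / 2) (⇑EuclideanSpace.complexify ∘ u t) ^ 2 := by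
        rw [← mul_assoc, ENNReal.inv_mul_cancel (by norm_num) (by norm_num), one_mul]

/-- **L57 — CHESKIDOV–ZAYA'S THEOREM 2.4 AS PRINTED (with the viscosity).** There is an absolute `c > 0` such that
for every `ν > 0`, `T > 0`, every maximal smooth solution `(u, p)` of the unforced Navier–Stokes system on
`ℝ³ × [0, T)` (classical on `[0, T)`, no classical continuation past `T`) which is a Leray–Hopf weak solution from
`u 0`, and EVERY `t ∈ (0, T)`:
`c · ν^{1/2} · (T − t)^{−1/2} ≤ ‖u(t)‖_{Ḣ^{3/2}}` —
the ENDPOINT `s = 3/2` of the Sobolev ladder L52 (`HomSobolevLadder.homSobolev_clock`: `c_s ν^{(5−2s)/4}(T−t)^{−(2s−1)/4}`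
for `1/2 < s < 3/2`) with the same shape, reached not by interpolation but by the Riccati law of the row (L56)
and `Ḃ^{3/2}_{2,2} = Ḣ^{3/2}`: the printed OPTIMAL lower bound `‖u(t)‖_{Ḣ^{3/2}} ≥ c/√(T* − t)` (there `ν = 1`). The
seminorm is the tree's `Function.eHomSobolevSeminorm (3/2)` of the complexified slice (`∞` off `Ḣ^{3/2}`, where the floor
is trivial). Necessity only. [cite: CheskidovZaya2016, Thm. 2.4] -/
theorem homSobolev32_clock :
    ∃ c : ℝ, 0 < c ∧ ∀ (ν T : ℝ), 0 < ν → 0 < T →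
      ∀ (u : ℝ → EuclideanSpace ℝ (Fin 3) → EuclideanSpace ℝ (Fin 3)) (p : ℝ → EuclideanSpace ℝ (Fin 3) → ℝ),
      IsMaximalSmoothSolution ν 0 u p T → IsLerayHopfOn T ν 0 (u 0) u →
      ∀ t ∈ Ioo 0 T,
        ENNReal.ofReal (c * ν ^ (1 / 2 : ℝ) * (T - t) ^ (-(1 / 2 : ℝ))) ≤
          Function.eHomSobolevSeminorm (3 / 2) (⇑EuclideanSpace.complexify ∘ u t) := by
  obtain ⟨c, hc, H⟩ := homSobolev32_clock_sq
  refine ⟨c ^ (1 / 2 : ℝ), by positivity, fun ν T hν hT u p hmax hLH t ht => ?_⟩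
  have hTt : 0 < T - t := sub_pos.2 ht.2
  have h := H ν T hν hT u p hmax hLH t ht
  have hA : 0 ≤ c * ν ^ (1 : ℝ) * (T - t) ^ (-(1 : ℝ)) := by positivity
  have h' := ENNReal.rpow_le_rpow h (by norm_num : (0 : ℝ) ≤ 1 / 2)
  have hX : (Function.eHomSobolevSeminorm (3 / 2) (⇑EuclideanSpace.complexify ∘ u t) ^ 2) ^ (1 / 2 : ℝ) =
      Function.eHomSobolevSeminorm (3 / 2) (⇑EuclideanSpace.complexify ∘ u t) := by
    rw [← ENNReal.rpow_natCast, ← ENNReal.rpow_mul]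
    norm_num
  rw [hX, ENNReal.ofReal_rpow_of_nonneg hA (by norm_num)] at h'
  refine le_trans (le_of_eq ?_) h'
  congr 1
  rw [Real.mul_rpow (by positivity) (Real.rpow_nonneg hTt.le _), Real.mul_rpow hc.le (Real.rpow_nonneg hν.le _),
    ← Real.rpow_mul hν.le, ← Real.rpow_mul hTt.le]
  norm_num

/-- **L57′ — `‖u(t)‖_{Ḣ^{3/2}} → ∞` as `t ↑ T`** along every maximal smooth Leray–Hopf solution of the unforced system
(`ν > 0`), at the optimal rate of `homSobolev32_clock`. [cite: CheskidovZaya2016, Thm. 2.4] -/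
theorem homSobolev32_tendsto_top {ν T : ℝ} (hν : 0 < ν) (hT : 0 < T)
    {u : ℝ → EuclideanSpace ℝ (Fin 3) → EuclideanSpace ℝ (Fin 3)} {p : ℝ → EuclideanSpace ℝ (Fin 3) → ℝ}
    (hmax : IsMaximalSmoothSolution ν 0 u p T) (hLH : IsLerayHopfOn T ν 0 (u 0) u) :
    Tendsto (fun t => Function.eHomSobolevSeminorm (3 / 2) (⇑EuclideanSpace.complexify ∘ u t)) (𝓝[<] T) (𝓝 ∞) := by
  obtain ⟨c, hc, H⟩ := homSobolev32_clock
  refine tendsto_nhds_top_mono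
    (tendsto_ofReal_clock_top (a := (1 / 2 : ℝ)) (T := T) hc hν (by norm_num : (0 : ℝ) < 1 / 2)) ?_
  filter_upwards [Ioo_mem_nhdsLT hT] with t ht
  exact H ν T hν hT u p hmax hLH t ht

/-! ## L52 in the ℓ² dyadic currency -/

/-- **L52 IN THE ℓ² DYADIC CURRENCY (scaling-sharp rows below `3/2`, lossless).** For every `s ∈ (1/2, 3/2)` there is
`c = c_s > 0` such that along every maximal smooth solution `(u, p)` of the unforced Navier–Stokes system on
`ℝ³ × [0, T)` (`ν > 0`) which is Leray–Hopf from `u 0`, at EVERY `t ∈ (0, T)`: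
`c · ν^{(5−2s)/2} · (T − t)^{−(2s−1)/2} ≤ ∑_{j∈ℤ} 4^{sj} ‖Δ̇_j u(t)‖₂²` — L52 (`homSobolev_clock`) squared and read through
`‖u‖²_{Ḣ^s} ≤ 2·4^s ∑_j 4^{sj}a_j²` (`eHomSobolevSeminorm_sq_le_tsum_weight_blockL2`). The ℓ¹ ladder L51 gives these
ℓ² rows only after a Cauchy–Schwarz loss; at `s = 3/2` the row is L56 (optimal, by the Riccati law instead).
[cite: RobinsonSadowski2014, Corollary 10] [cite: RobinsonSadowskiSilva2012, Thm. 1.1]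
[cite: BahouriCheminDanchin2011, §2.3 (Ḃ^s_{2,2} = Ḣ^s)] -/
theorem dyadic_clock_of_homSobolev (s : ℝ) (hs : s ∈ Ioo (1 / 2 : ℝ) (3 / 2)) :
    ∃ c : ℝ, 0 < c ∧ ∀ (ν T : ℝ), 0 < ν → 0 < T →
      ∀ (u : ℝ → EuclideanSpace ℝ (Fin 3) → EuclideanSpace ℝ (Fin 3)) (p : ℝ → EuclideanSpace ℝ (Fin 3) → ℝ),
      IsMaximalSmoothSolution ν 0 u p T → IsLerayHopfOn T ν 0 (u 0) u →
      ∀ t ∈ Ioo 0 T,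
        ENNReal.ofReal (c * ν ^ ((5 - 2 * s) / 2) * (T - t) ^ (-((2 * s - 1) / 2))) ≤
          ∑' j : ℤ, (2 : ℝ≥0∞) ^ (2 * s * (j : ℝ)) * blockL2 (u t) j ^ 2 := by
  obtain ⟨c, hc, H⟩ := homSobolev_clock s hs
  have hs0 : 0 < s := by linarith [hs.1]
  -- the comparison constant `2 · 2^{2s}` as a real number
  set M : ℝ := 2 * (2 : ℝ) ^ (2 * s) with hM
  have hM0 : 0 < M := by positivity
  have hMe : (2 : ℝ≥0∞) * (2 : ℝ≥0∞) ^ |2 * s| = ENNReal.ofReal M := by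
    rw [abs_of_pos (by linarith), hM, ENNReal.ofReal_mul (by norm_num), ← ENNReal.ofReal_rpow_of_pos two_pos,
      ENNReal.ofReal_ofNat]
  refine ⟨c ^ 2 / M, by positivity, fun ν T hν hT u p hmax hLH t ht => ?_⟩
  have hTt : 0 < T - t := sub_pos.2 ht.2
  have hut : MemLp (u t) 2 volume := hLH.memLp t ⟨ht.1.le, ht.2.le⟩
  have h := H ν T hν hT u p hmax hLH t ht
  have h' := pow_le_pow_left' h 2
  have hsq : ENNReal.ofReal (c * ν ^ ((5 - 2 * s) / 4) * (T - t) ^ (-((2 * s - 1) / 4))) ^ 2 =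
      ENNReal.ofReal (c ^ 2 * ν ^ ((5 - 2 * s) / 2) * (T - t) ^ (-((2 * s - 1) / 2))) := by
    rw [← ENNReal.ofReal_pow (by positivity)]
    congr 1
    rw [mul_pow, mul_pow, ← Real.rpow_natCast (ν ^ _), ← Real.rpow_natCast ((T - t) ^ _),
      ← Real.rpow_mul hν.le, ← Real.rpow_mul hTt.le]
    congr 2 <;> push_cast <;> ring
  rw [hsq] at h'
  have hcmp := eHomSobolevSeminorm_sq_le_tsum_weight_blockL2 s hut
  rw [hMe] at hcmp
  -- `ofReal (c²…) ≤ ‖u‖² ≤ M · Y`, hence `ofReal (c²…/M) ≤ Y`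
  have h3 := h'.trans hcmp
  have e : c ^ 2 / M * ν ^ ((5 - 2 * s) / 2) * (T - t) ^ (-((2 * s - 1) / 2)) =
      M⁻¹ * (c ^ 2 * ν ^ ((5 - 2 * s) / 2) * (T - t) ^ (-((2 * s - 1) / 2))) := by
    field_simp
  rw [e, ENNReal.ofReal_mul (by positivity), ENNReal.ofReal_inv_of_pos hM0]
  calc (ENNReal.ofReal M)⁻¹ * ENNReal.ofReal (c ^ 2 * ν ^ ((5 - 2 * s) / 2) * (T - t) ^ (-((2 * s - 1) / 2)))
      ≤ (ENNReal.ofReal M)⁻¹ * (ENNReal.ofReal M * ∑' j : ℤ, (2 : ℝ≥0∞) ^ (2 * s * (j : ℝ)) * blockL2 (u t) j ^ 2) :=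
        mul_le_mul_right h3 _
    _ = ∑' j : ℤ, (2 : ℝ≥0∞) ^ (2 * s * (j : ℝ)) * blockL2 (u t) j ^ 2 := by
        rw [← mul_assoc, ENNReal.inv_mul_cancel (by rwa [ne_eq, ENNReal.ofReal_eq_zero, not_le])
          ENNReal.ofReal_ne_top, one_mul]

/-! ## The interface reading -/

/-- **L57 READ ON THE INTERFACE: every cascade witness blows up in `Ḣ^{3/2}` at the optimal rate.** Every
`W : CascadeWitness` yields `ν > 0`, `T > 0` and a maximal smooth solution `(u, p)` of the unforced Navier–Stokes system
on `ℝ³ × [0, T)`, Leray–Hopf from `u 0` (`x5a_of_cascadeWitness'`), such that, with the absolute constant `c` of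
`homSobolev32_clock`: `c ν^{1/2} (T − t)^{−1/2} ≤ ‖u(t)‖_{Ḣ^{3/2}}` at every `t ∈ (0, T)`, and `‖u(t)‖_{Ḣ^{3/2}} → ∞` as
`t ↑ T`. Completes `HomSobolevLadder.homSobolev_clock_of_cascadeWitness` (`1/2 < s < 3/2`) at the endpoint.
[cite: CheskidovZaya2016, Thm. 2.4] -/
theorem homSobolev32_clock_of_cascadeWitness (W : CascadeWitness) :
    ∃ ν : ℝ, 0 < ν ∧ ∃ T : ℝ, 0 < T ∧
      ∃ (u : ℝ → EuclideanSpace ℝ (Fin 3) → EuclideanSpace ℝ (Fin 3)) (p : ℝ → EuclideanSpace ℝ (Fin 3) → ℝ),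
        IsMaximalSmoothSolution ν 0 u p T ∧ IsLerayHopfOn T ν 0 (u 0) u ∧
        (∀ t ∈ Ioo 0 T,
          ENNReal.ofReal (homSobolev32_clock.choose * ν ^ (1 / 2 : ℝ) * (T - t) ^ (-(1 / 2 : ℝ))) ≤
            Function.eHomSobolevSeminorm (3 / 2) (⇑EuclideanSpace.complexify ∘ u t)) ∧
        Tendsto (fun t => Function.eHomSobolevSeminorm (3 / 2) (⇑EuclideanSpace.complexify ∘ u t))
          (𝓝[<] T) (𝓝 ∞) := by
  obtain ⟨ν, hν, T, hT, u, p, hmax, hLH, -⟩ := x5a_of_cascadeWitness' W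
  exact ⟨ν, hν, T, hT, u, p, hmax, hLH, homSobolev32_clock.choose_spec.2 ν T hν hT u p hmax hLH,
    homSobolev32_tendsto_top hν hT hmax hLH⟩

end Summit.NavierStokesRegularity.FluidComputer.HomSobolev32Clock

end
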